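import Summits.Ventures.HSemireg.MarkmanClassStatementAssembly
import Summits.Ventures.HSemireg.ComponentCells
import Summits.Ventures.HSemireg.AmplificationChainG4RouteC
import Literature.AlgebraicGeometry.HodgeTheory.WeilTypeAbelianVariety
import Literature.AlgebraicGeometry.HodgeTheory.WeilClassesRationalPlane
import HarnessLib

/-!
# Venture HSemireg — Markman's class statement ON THE COMPONENT OF THE ANCHOR, ANY DISCRIMINANT: the printed sentence
# «on every polarized abelian variety of Weil type in the connected component of moduli containing [the anchor]» read in the
# cell currency `(n, K = ℚ(√-d), δ = det H)` — `WeilClassesComponent n d δ`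

HONEST FRAMING. Lean index of the computation cell `pub-hsemireg` (seat p5); proof-only companion of `MarkmanClassStatement.lean`
(printed passages, POINTWISE statement), `MarkmanKappaShape.lean` (the class-side predicate `IsMarkmanKappaShape`) and
`MarkmanClassStatementAssembly.lean` (the SPLIT component through the door-agnostic assembly). Nothing about any explicit variety is
asserted; every published input is a hypothesis BY NAME (`weilFamilyReach_similar`, the assembly's `LocalVariationalHodgeFor 𝒪`) or BY
VALUE (the anchor, its Weil type and Gram placement, the class shape, the object clause); nothing here says that HC, HC_CM or HC_AV is
proved. For the NON-split SIXFOLD components and every component with `n ≥ 4` NOTHING below is a theorem in print (the cell's «deciding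
rows»; fourfold cells `n = 2`: §5); the file states what ONE admissible object at ONE polarized Weil-type point of such a component would
give, as an implication. 0 `sorry`, 0 definitions, 0 new named facts.

## The printed sentence and the dictionary
[Mar25b] = arXiv:2509.23403 §4 (PDF p. 9 line 54 – p. 10 line 10): «Conditions (2a) and (2b) and the Semi-regularity theorem imply that `κ(E)` remains algebraic on every
polarized abelian variety of Weil type `(A,η′,h′)` in the connected component of moduli containing `(X×X̂,η,h)`. […] Hence every
class in `HW(A,η′)` is algebraic.» The sentence does not depend on the component being the split one; Markman's own anchor `X×X̂`
happens to lie on the component of discriminant `(-1)ⁿ` ([Mar25] Lemma 3.1.3), which is why `MarkmanClassStatementAssembly.lean`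
reads it through the hyperbolic reach. Here the anchor `(P, ψ₀, h)` is an arbitrary polarized abelian `2n`-fold of Weil type and
«the connected component of moduli containing» it is rendered by the printed invariant of [Mar25] §1.1: «The determinant of the
matrix of `H`, with respect to some `K`-basis of `H_1(A,ℚ)`, is an element of `ℚ^×` and its image in `ℚ^×/Nm(K^×)` is called the
discriminant `det H` of `(A,η,h)`.» and «The triple `(n,K,det H)`, consisting of half the dimension of `A`, an imaginary quadratic
number field `K`, and the discriminant `det H`, is a discrete invariant of a component of the moduli space, which determines it up to
isogenies of abelian varieties of Weil type [van-Geemen].» (both §1.1 sentences as in the held TeX e-print text, whose cite key «[van-Geemen]» = [vanGeemen1994HodgeAV] stands where the PDF prints its bibliography label.) In the tree: the cell `(n, d, δ)`, `δ ∈ weilNormResidueGroup d = ℚˣ/Nm Kˣ`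
the class of `det H` of the `K`-Hermitian form of the polarization (`VanGeemen1994.HasWeilDiscriminantNondeg A φ n d h_K δ`, van Geemen
Lemma 5.2 (2)–(3), 4.14), and the class target **`Ring2.Hypotheses.WeilClassesComponent n d δ`**: every rational `(n,n)` class of the
Weil plane of EVERY polarized member `(A, φ, h_K = d·e^*a + φ^*e^*a)` of the cell is algebraic — literally «every class in `HW(A,η′)`
is algebraic» for every `(A,η′,h′)` of the component. Reach inside the cell: Deligne's polarized family through the anchor reaches every
Weil-SIMILAR member up to `K`-isogeny (`weilFamilyReach_similar`, REFEREED: LNM 900, proof of Thm. 4.8), and same `(n, d, δ)` ⟹ Weil-similar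
is Landherr's theorem (tree THEOREM `Ring2.AbelianAll.isWeilSimilar_of_hasWeilDiscriminantNondeg`) — both inside the cell's door-independent
member form `weilClassesComponent_of_localClause_member` (`ComponentCells.lean`), which this file feeds.

Arrow by arrow (as in `MarkmanClassStatementAssembly.lean`, with the component generalised):
* anchor «`(X×X̂, η, h)`» ↦ a polarized abelian `2n`-fold `(P, ψ₀, h)` of Weil type `(n, d)` (`IsWeilType P ψ₀ n d`: van Geemen 4.9),
  `h` Markman's polarization with `ψ₀^*h = d·h` ([Mar25] §1.3 «`η(k)` maps `h` to `Nm(k)h`») and `ι^*a = m·h` for a projective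
  embedding `ι`, `m ∈ ℚ^×` — so the tree's `K`-symmetrised class is `symmetrisedClass d P ψ₀ ι a = 2dm·h`
  (`symmetrisedClass_eq_smul_of_map_eq`) and has the same discriminant class (`hasWeilDiscriminantNondeg_ratCast_smul_iff`);
* (a) + «the object» ↦ the assembly's object clause `𝒪 (2n) P.X I κ`, «the Semi-regularity theorem» ↦ `LocalVariationalHodgeFor 𝒪`
  (BF 2003 Thm. 5.1 for sheaves = `localVariationalHodgeFor_bfSheafClass`; for complexes Pridham 2024 Cor. 2.25 / Rem. 2.27 + Perry 2022
  Prop. 8.1 on paper = the route-(C) assumption `PerfectComplexRankTransfer C` of seat p4, BY NAME — the kernel links it to nothing);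
* (b) + (c) ↦ `IsMarkmanKappaShape n d P ψ₀ h I κ w` ([Mar25] Cor. 1.3.2 + Lemma 2.2.7 / Cor. 4.0.4 + Thm. 1.4.1(4));
* «remains algebraic on every `(A,η′,h′)` in the connected component» + «Hence every class in `HW(A,η′)` is algebraic» ↦
  `WeilClassesComponent n d δ` for the anchor's `δ`, and its reading `weilClassesOf A φ n d ≤ algebraicClasses A.X n` on a member.
Contents: §1 `IsMarkmanKappaShape.weilAnchorLocalClause` (door output at the anchor); §2
`weilClassesComponent_of_reachSimilar_of_localVariationalHodgeFor_of_isMarkmanKappaShape{,_polarization}` (anchor in the symmetrised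
class / in Markman's `h`); §3 member readings `weilClassesOf_le_algebraicClasses_of_weilClassesComponent_of_isWeilType`,
`weilClassesOf_member_le_algebraicClasses_…`; §4 the `g = 6` / `g = 8` instances (the cell's DECIDING rows — OPEN in print; nothing
claimed); §5 [Mar25] §1.6 first sentence: the conditional SPLIT sixfold statement settles `WeilAlgebraicAll 2 d` and every fourfold cell
of the same `K` (Schoen's descent is PROVED in the tree); §6 the split statements as the split cell `WeilClassesComponent N d [(-1)ᴺ]`
(Landherr's converse, tree theorem); §7 route (C) on real carriers (`PerfectComplexRankTransfer C` BY NAME, a rank-admissible complex `E`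
BY VALUE). The seed-level sibling (any `HasSeedOn 𝒪`) is t-7's `weilClassesComponent_of_localVariationalHodgeFor_of_seedOn_member`
(`ComponentCellsRouteC.lean`); this file composes the landed `weilClassesComponent_of_localClause_member` and
`weilAnchorLocalClause_of_localVariationalHodgeFor_of_seedOn` directly and does not depend on that file.
References: [Markman2025SurveySecant] arXiv:2509.23403 §4 — a SURVEY, published: Proc. ICM 2026 Vol. 3 (SIAM, 2026) pp. 586–602, bib
`Markman2026ICMSecant` (SIAM numbering not verified against the arXiv text); the RESULTS it reports are proved in [Markman2025SecantWeil],
a PREPRINT: arXiv:2502.03415 v2 §1.1, §1.3, Cor. 1.3.2, Thm. 1.4.1, §1.6, Lemma 2.2.7, Lemma 3.1.3, Cor. 4.0.4; [Deligne1982HodgeCycles]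
LNM 900, proof of Thm. 4.8; [vanGeemen1994HodgeAV] LNM 1594, 4.9–4.10, 4.14, Lemma 5.2, Thm. 5.3, 5.4; [Landherr1936HermitianForms];
[BuchweitzFlenner2003] Thm. 5.1; [Schoen1998HodgeWeilAddendum] §10.
-/

noncomputable section

open CategoryTheory AlgebraicGeometry

namespace Summit.Ventures.HSemireg

open Literature.AlgebraicGeometry Literature.AlgebraicGeometry.Motives
open Literature.AlgebraicGeometry.HodgeTheory
open Literature.AlgebraicGeometry.VanGeemen1994
open Literature.AlgebraicTopology.SingularHomology
open Summit.HodgeConjecture.HodgeConjecture.Ring2.Hypotheses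

/-! ## §1 The door output at the anchor, in Markman's polarization -/

section Anchor

variable {𝒪 : ObjClass} {n d : ℕ} {P : AbelianVariety ℂ} {ψ₀ : P ⟶ P} {h : complexBetti P.X 2} {I : Finset ℕ}
  {κ : (p : ℕ) → complexBetti P.X (2 * p)} {w : complexBetti P.X (2 * n)}

/-- **«Conditions (2a) and (2b) and the Semi-regularity theorem imply that `κ(E)` remains algebraic» — locally at the anchor**:
`LocalVariationalHodgeFor 𝒪` (BY NAME), `IsMarkmanKappaShape n d P ψ₀ h I κ w` and an admissible object `𝒪 (2n) P.X I κ`, `n ∈ I`, give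
the tree's LOCAL CLAUSE `WeilAnchorLocalClause n d' P h w` for every `d'` (along every smooth projective `√-d'`-Weil family through a chart
at `P`, `q·Hⁿ + W` stays algebraic near `P`): the assembly's door fed with the seed of `IsMarkmanKappaShape.hasSeedOn`.
[cite: Markman2025SurveySecant, §4 conditions (a)–(c)] [cite: BuchweitzFlenner2003, §5 Thm. 5.1 (the argument shape)] -/
theorem IsMarkmanKappaShape.weilAnchorLocalClause (hT : LocalVariationalHodgeFor 𝒪)
    (hS : IsMarkmanKappaShape n d P ψ₀ h I κ w) (hnI : n ∈ I) (h𝒪 : 𝒪 (2 * n) P.X I κ) (d' : ℕ) :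
    WeilAnchorLocalClause n d' P h w :=
  weilAnchorLocalClause_of_localVariationalHodgeFor_of_seedOn d' hT (hS.hasSeedOn hnI h𝒪)

end Anchor

/-! ## §2 Markman's class statement on the component `(n, K, δ)` of the anchor -/

section Component

variable {𝒪 : ObjClass} {n d : ℕ} {δ : weilNormResidueGroup d}

/-- **MARKMAN'S CLASS STATEMENT, component level, ANY discriminant — anchor stated in the tree's `K`-symmetrised class.**
GIVEN BY NAME: Deligne's reach-by-similitude `weilFamilyReach_similar` (REFEREED) and «the Semi-regularity theorem» for the object
class `𝒪` (`LocalVariationalHodgeFor 𝒪`). GIVEN BY VALUE: an anchor `(P, ψ₀)` of Weil type `(n, d)` (van Geemen 4.9), a projective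
embedding `ι` and a rational `a ≠ 0` whose `K`-symmetrised class `h_K = d·ι^*a + ψ₀^*ι^*a` has non-degenerate discriminant class
`δ = det H` (the component invariant of [Mar25] §1.1), Markman's class hypothesis `IsMarkmanKappaShape n d P ψ₀ h_K I κ w`
(conditions (b)+(c): `κ_n = q·h_Kⁿ + w`, `w ≠ 0` rational Weil, `κ_p ∈ ℚ·h_Kᵖ` on `I`), `n ∈ I`, and an admissible object
`𝒪 (2n) P.X I κ` (condition (a)). THEN «every class in `HW(A,η′)` is algebraic» for every polarized member of the component:
`WeilClassesComponent n d δ`. (`weilClassesComponent_of_localClause_member` fed with §1; same `(n, d, δ)` ⟹ Weil-similar is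
Landherr's theorem inside that declaration.) Decides nothing by itself; for `n = 3` with `δ ≠ [-1]` and for every `δ` when `n ≥ 4`
nothing is in print (the fourfold cells `n = 2` are in print for `K = ℚ(√-3)`, `ℚ(i)` and, granted [Mar25] Thm. 1.5.1, for every `K`: §5).
[cite: Markman2025SurveySecant, §4] [cite: Markman2025SecantWeil, §1.1 (the invariant (n, K, det H); preprint)]
[cite: Deligne1982HodgeCycles, proof of Thm. 4.8] [cite: vanGeemen1994HodgeAV, Lemma 5.2 (2)–(4) and Thm. 5.3] -/
theorem weilClassesComponent_of_reachSimilar_of_localVariationalHodgeFor_of_isMarkmanKappaShape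
    (hF : weilFamilyReach_similar) (hT : LocalVariationalHodgeFor 𝒪) {P : AbelianVariety ℂ} {ψ₀ : P ⟶ P}
    (hW : IsWeilType P ψ₀ n d) (ι : ProjectiveEmbedding P.X) {a : complexBetti (projectiveSpace ι.n ℂ) 2}
    (ha : IsRationalClass a) (ha0 : a ≠ 0) (hδ : HasWeilDiscriminantNondeg P ψ₀ n d (symmetrisedClass d P ψ₀ ι a) δ)
    {I : Finset ℕ} {κ : (p : ℕ) → complexBetti P.X (2 * p)} {w : complexBetti P.X (2 * n)}
    (hS : IsMarkmanKappaShape n d P ψ₀ (symmetrisedClass d P ψ₀ ι a) I κ w) (hnI : n ∈ I)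
    (h𝒪 : 𝒪 (2 * n) P.X I κ) : WeilClassesComponent n d δ :=
  weilClassesComponent_of_localClause_member hF hW ι ha ha0 hδ hS.mem_weilClassesOf hS.isRationalClass hS.ne_zero
    (hS.weilAnchorLocalClause hT hnI h𝒪 d)

/-- **MARKMAN'S CLASS STATEMENT, component level, ANY discriminant — anchor stated in MARKMAN'S POLARIZATION `h`** (how a
census row enters): as `weilClassesComponent_of_reachSimilar_of_localVariationalHodgeFor_of_isMarkmanKappaShape`, with the Gram
placement `det H = δ` and the class hypothesis stated for Markman's `h` itself — `ψ₀^*h = d·h` ([Mar25] §1.3), `ι^*a = m·h`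
(`m ∈ ℚ^×`); the symmetrised class is `2dm·h`, and both the discriminant class (`hasWeilDiscriminantNondeg_ratCast_smul_iff`, van
Geemen 5.2 (3)) and the class shape (`IsMarkmanKappaShape.symmetrised`) are insensitive to that rescaling. Conclusion
`WeilClassesComponent n d δ`. [cite: Markman2025SurveySecant, §4] [cite: Markman2025SecantWeil, §1.1 and §1.3 (preprint)]
[cite: Markman2026ICMSecant, §4 of the arXiv text (published ICM 2026 survey reporting it; proof = Markman2025SecantWeil, preprint)]
[cite: Deligne1982HodgeCycles, proof of Thm. 4.8] [cite: vanGeemen1994HodgeAV, Lemma 5.2 (2)–(4)] -/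
theorem weilClassesComponent_of_reachSimilar_of_localVariationalHodgeFor_of_isMarkmanKappaShape_polarization
    (hF : weilFamilyReach_similar) (hT : LocalVariationalHodgeFor 𝒪) {P : AbelianVariety ℂ} {ψ₀ : P ⟶ P}
    (hW : IsWeilType P ψ₀ n d) (ι : ProjectiveEmbedding P.X) {a : complexBetti (projectiveSpace ι.n ℂ) 2}
    (ha : IsRationalClass a) (ha0 : a ≠ 0) {h : complexBetti P.X 2} {m : ℚ} (hm : m ≠ 0)
    (hι : complexBetti.map ι.ι 2 a = ((m : ℚ) : ℂ) • h) (hψh : complexBetti.map ψ₀.hom.hom.hom 2 h = (d : ℂ) • h)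
    (hδ : HasWeilDiscriminantNondeg P ψ₀ n d h δ) {I : Finset ℕ} {κ : (p : ℕ) → complexBetti P.X (2 * p)}
    {w : complexBetti P.X (2 * n)} (hS : IsMarkmanKappaShape n d P ψ₀ h I κ w) (hnI : n ∈ I) (h𝒪 : 𝒪 (2 * n) P.X I κ) :
    WeilClassesComponent n d δ := by
  refine weilClassesComponent_of_reachSimilar_of_localVariationalHodgeFor_of_isMarkmanKappaShape hF hT hW ι ha ha0 ?_
    (hS.symmetrised hW.d_pos ι a hm hι hψh) hnI h𝒪
  rw [symmetrisedClass_eq_smul_of_map_eq ι a hι hψh]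
  have hd' : (d : ℚ) ≠ 0 := by exact_mod_cast hW.d_pos.ne'
  exact (hasWeilDiscriminantNondeg_ratCast_smul_iff (mul_ne_zero (mul_ne_zero two_ne_zero hd') hm)).2 hδ

end Component

/-! ## §3 «Hence every class in `HW(A,η′)` is algebraic» — the reading on a Weil-type member of the component -/

section Member

variable {n d : ℕ} {δ : weilNormResidueGroup d}

/-- **Reading of the cell target on a member.** If `WeilClassesComponent n d δ` holds, then on every `(A, φ)` of Weil type `(n, d)`
polarized in the cell (a projective embedding `e_A`, a rational `a_A ≠ 0`, `det H = δ` for `h_A = d·e_A^*a_A + φ^*e_A^*a_A`) the WHOLE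
Weil plane is algebraic: `weilClassesOf A φ n d ≤ algebraicClasses A.X n`. (The Weil
plane of a Weil-type pair is a rational plane of type `(n, n)` — `exists_isRationalClass_ne_zero_mem_weilClassesOf`,
`IsWeilType.isOfHodgeType_of_mem_weilClassesOf` — and ONE non-zero algebraic class suffices: `weilClassesOf_le_algebraicClasses_iff_exists_ne_zero_of_dim_eq`.)
[cite: vanGeemen1994HodgeAV, 4.9–4.10 and Lemma 5.2 (5)–(6)] [cite: Markman2025SurveySecant, §4 («HW(A,η′) is 1-dimensional over K»)] -/
theorem weilClassesOf_le_algebraicClasses_of_weilClassesComponent_of_isWeilType (hC : WeilClassesComponent n d δ)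
    {A : AbelianVariety ℂ} {φ : A ⟶ A} (hA : IsWeilType A φ n d) (eA : ProjectiveEmbedding A.X)
    {aA : complexBetti (projectiveSpace eA.n ℂ) 2} (haA : IsRationalClass aA) (haA0 : aA ≠ 0)
    (hδA : HasWeilDiscriminantNondeg A φ n d (symmetrisedClass d A φ eA aA) δ) :
    weilClassesOf A φ n d ≤ algebraicClasses A.X n := by
  obtain ⟨c, hcW, hc0, hcr⟩ := exists_isRationalClass_ne_zero_mem_weilClassesOf hA.pos hA.dim_eq hA.d_pos hA.sq_eq
  exact (weilClassesOf_le_algebraicClasses_iff_exists_ne_zero_of_dim_eq abelianVarietyCohomologyExteriorH1_holds hA.dim_eq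
      hA.pos hA.d_pos hA.sq_eq).2
    ⟨c, hcW, hC A φ hA.dim_eq hA.isSmoothProjective hA.sq_eq eA aA haA haA0 hδA c hcr
      (hA.isOfHodgeType_of_mem_weilClassesOf hcW) hcW, hc0⟩

/-- **Markman's class statement, member by member, any discriminant** (the printed sentence unfolded): under the hypotheses of
`weilClassesComponent_of_reachSimilar_of_localVariationalHodgeFor_of_isMarkmanKappaShape_polarization` (reach and `LocalVariationalHodgeFor 𝒪`
BY NAME, ONE polarized Weil-type anchor `(P, ψ₀, h)` with `det H = δ` carrying an admissible object whose classes have Markman's shape),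
for EVERY «polarized abelian variety of Weil type `(A,η′,h′)` in the connected component of moduli containing» the anchor — every `(A, φ)`
of Weil type `(n, d)` with a polarizing pair `(e_A, a_A)` of the same discriminant class `δ` ([Mar25] §1.1) — «every class in `HW(A,η′)` is
algebraic»: `weilClassesOf A φ n d ≤ algebraicClasses A.X n`. [cite: Markman2025SurveySecant, §4] [cite: Markman2025SecantWeil, §1.1 (preprint)]
[cite: Deligne1982HodgeCycles, proof of Thm. 4.8] [cite: vanGeemen1994HodgeAV, Lemma 5.2 and Thm. 5.3] -/
theorem weilClassesOf_member_le_algebraicClasses_of_reachSimilar_of_localVariationalHodgeFor_of_isMarkmanKappaShape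
    {𝒪 : ObjClass} (hF : weilFamilyReach_similar) (hT : LocalVariationalHodgeFor 𝒪) {P : AbelianVariety ℂ} {ψ₀ : P ⟶ P}
    (hW : IsWeilType P ψ₀ n d) (ι : ProjectiveEmbedding P.X) {a : complexBetti (projectiveSpace ι.n ℂ) 2}
    (ha : IsRationalClass a) (ha0 : a ≠ 0) {h : complexBetti P.X 2} {m : ℚ} (hm : m ≠ 0)
    (hι : complexBetti.map ι.ι 2 a = ((m : ℚ) : ℂ) • h) (hψh : complexBetti.map ψ₀.hom.hom.hom 2 h = (d : ℂ) • h)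
    (hδ : HasWeilDiscriminantNondeg P ψ₀ n d h δ) {I : Finset ℕ} {κ : (p : ℕ) → complexBetti P.X (2 * p)}
    {w : complexBetti P.X (2 * n)} (hS : IsMarkmanKappaShape n d P ψ₀ h I κ w) (hnI : n ∈ I) (h𝒪 : 𝒪 (2 * n) P.X I κ)
    {A : AbelianVariety ℂ} {φ : A ⟶ A} (hA : IsWeilType A φ n d) (eA : ProjectiveEmbedding A.X)
    {aA : complexBetti (projectiveSpace eA.n ℂ) 2} (haA : IsRationalClass aA) (haA0 : aA ≠ 0)
    (hδA : HasWeilDiscriminantNondeg A φ n d (symmetrisedClass d A φ eA aA) δ) :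
    weilClassesOf A φ n d ≤ algebraicClasses A.X n :=
  weilClassesOf_le_algebraicClasses_of_weilClassesComponent_of_isWeilType
    (weilClassesComponent_of_reachSimilar_of_localVariationalHodgeFor_of_isMarkmanKappaShape_polarization hF hT hW ι ha ha0 hm
      hι hψh hδ hS hnI h𝒪) hA eA haA haA0 hδA

end Member

/-! ## §4 The cell's deciding rows: `g = 6` (every sixfold component `(3, d, δ)`) and `g = 8` (every eightfold component) -/

section Instances

variable {𝒪 : ObjClass} {d : ℕ} {δ : weilNormResidueGroup d}

/-- **`g = 6`, any sixfold component `(3, K = ℚ(√-d), δ)`** — the kernel name a NON-SPLIT census row would instantiate: reach and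
`LocalVariationalHodgeFor 𝒪` BY NAME, a polarized Weil-type `(3, d)` anchor `(P, ψ₀, h)` (`ψ₀^*h = d·h`, `ι^*a = m·h`, `det H = δ`), an
admissible object `𝒪 6 P.X I κ`, `3 ∈ I`, of shape `IsMarkmanKappaShape 3 d P ψ₀ h I κ w` ⟹ `WeilClassesComponent 3 d δ`. In print ONLY the
split cell `δ = [-1]` is covered ([Mar25] Thm. 1.5.1, preprint; Schoen / Koike for `ℚ(√-3)` / `ℚ(i)`, refereed); every other realisable cell is
OPEN and nothing about it is claimed. Instance `n = 3` of `…_polarization`. [cite: Schoen1998HodgeWeilAddendum] [cite: Koike2004WeilHodge, Cor. 2.1 (arXiv:math/0211304 numbering)]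
[cite: Markman2025SurveySecant, §4] [cite: Markman2025SecantWeil, §1.1 (preprint)] [cite: Deligne1982HodgeCycles, proof of Thm. 4.8] -/
theorem weilSixfoldComponent_of_reachSimilar_of_localVariationalHodgeFor_of_isMarkmanKappaShape_polarization
    (hF : weilFamilyReach_similar) (hT : LocalVariationalHodgeFor 𝒪) {P : AbelianVariety ℂ} {ψ₀ : P ⟶ P}
    (hW : IsWeilType P ψ₀ 3 d) (ι : ProjectiveEmbedding P.X) {a : complexBetti (projectiveSpace ι.n ℂ) 2}
    (ha : IsRationalClass a) (ha0 : a ≠ 0) {h : complexBetti P.X 2} {m : ℚ} (hm : m ≠ 0)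
    (hι : complexBetti.map ι.ι 2 a = ((m : ℚ) : ℂ) • h) (hψh : complexBetti.map ψ₀.hom.hom.hom 2 h = (d : ℂ) • h)
    (hδ : HasWeilDiscriminantNondeg P ψ₀ 3 d h δ) {I : Finset ℕ} {κ : (p : ℕ) → complexBetti P.X (2 * p)}
    {w : complexBetti P.X (2 * 3)} (hS : IsMarkmanKappaShape 3 d P ψ₀ h I κ w) (h3I : 3 ∈ I) (h𝒪 : 𝒪 (2 * 3) P.X I κ) :
    WeilClassesComponent 3 d δ :=
  weilClassesComponent_of_reachSimilar_of_localVariationalHodgeFor_of_isMarkmanKappaShape_polarization hF hT hW ι ha ha0 hm hι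
    hψh hδ hS h3I h𝒪

/-- **`g = 8`, any eightfold component `(4, K = ℚ(√-d), δ)`** (all `g = 8` rows of the cell are deciding; NOTHING is in print for
`n = 4`, split or not): instance `n = 4` of `…_isMarkmanKappaShape_polarization`, conclusion `WeilClassesComponent 4 d δ`; an implication only.
[cite: Markman2025SurveySecant, §4] [cite: Markman2025SecantWeil, §1.1 (preprint)] [cite: Deligne1982HodgeCycles, proof of Thm. 4.8] -/
theorem weilEightfoldComponent_of_reachSimilar_of_localVariationalHodgeFor_of_isMarkmanKappaShape_polarization
    (hF : weilFamilyReach_similar) (hT : LocalVariationalHodgeFor 𝒪) {P : AbelianVariety ℂ} {ψ₀ : P ⟶ P}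
    (hW : IsWeilType P ψ₀ 4 d) (ι : ProjectiveEmbedding P.X) {a : complexBetti (projectiveSpace ι.n ℂ) 2}
    (ha : IsRationalClass a) (ha0 : a ≠ 0) {h : complexBetti P.X 2} {m : ℚ} (hm : m ≠ 0)
    (hι : complexBetti.map ι.ι 2 a = ((m : ℚ) : ℂ) • h) (hψh : complexBetti.map ψ₀.hom.hom.hom 2 h = (d : ℂ) • h)
    (hδ : HasWeilDiscriminantNondeg P ψ₀ 4 d h δ) {I : Finset ℕ} {κ : (p : ℕ) → complexBetti P.X (2 * p)}
    {w : complexBetti P.X (2 * 4)} (hS : IsMarkmanKappaShape 4 d P ψ₀ h I κ w) (h4I : 4 ∈ I) (h𝒪 : 𝒪 (2 * 4) P.X I κ) :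
    WeilClassesComponent 4 d δ :=
  weilClassesComponent_of_reachSimilar_of_localVariationalHodgeFor_of_isMarkmanKappaShape_polarization hF hT hW ι ha ha0 hm hι
    hψh hδ hS h4I h𝒪

end Instances

/-! ## §5 (appended) [Mar25] §1.6, first sentence: the sixfold statement settles every FOURFOLD cell of the same `K`

Printed ([Mar25] = arXiv:2502.03415 v2, §1.6, proof of Cor. 1.6.1, first sentence — PDF p. 9, lines 20–24 of the v2 text layer; the «p. 7» of this file's earlier versions was the held corpus chunk number, and the PDF prints «[S2, Prop. 10]» where that chunk has the cite key «[schoen]»): «Theorem 1.5.1 implies that the Hodge-Weil classes are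
algebraic for every abelian fourfold of Weil-type, for all imaginary quadratic number fields, and for all discriminants, by degenerating
abelian sixfolds of Weil type of discriminant `-1` to products of abelian fourfolds of Weil type of arbitrary discriminant and abelian
surfaces of Weil type [S2, Prop. 10].» The degeneration step is PROVED in the tree (Schoen's descent `stub_descend`, packaged as the
assembly's `weilAlgebraicAll_of_localVariationalHodgeFor_of_hyperbolicSeedOn_lt`), so for ONE `K = ℚ(√-d)` at a time the hypotheses of
the CONDITIONAL sixfold statement `weilSixfoldsSplit_of_reach_of_localVariationalHodgeFor_of_isMarkmanKappaShape` give
`WeilAlgebraicAll 2 d` (EVERY `√-d`-Weil fourfold, every discriminant), hence every fourfold cell `WeilClassesComponent 2 d δ`. Cor. 1.6.1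
itself (HC for abelian fourfolds: + [Moonen–Zarhin], [Ramón Marí]) is NOT typed. In print the fourfold conclusion is a theorem for
`ℚ(√-3)` (Schoen), `ℚ(i)` ([cite: Koike2004WeilHodge, Rem. 2.1, from Cor. 2.1 (sixfolds); arXiv:math/0211304 numbering]), and every `K` GRANTED Thm. 1.5.1 (preprint); below: implications only. -/

section FourfoldCells

open Summit.HodgeConjecture.HodgeConjecture.Cruxes.HodgeAbelianVarieties.EStepSecantInduction (WeilAlgebraicAll)

variable {𝒪 : ObjClass}

/-- **Below the seed level, any `N`** ([Mar25] §1.6 «by degenerating … [S2, Prop. 10]», iterated): hyperbolic reach and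
`LocalVariationalHodgeFor 𝒪` BY NAME, ONE split `√-d`-Weil anchor `(P, ψ₀, h)` of dimension `2N` in Markman's polarization with an
admissible object `𝒪 (2N) P.X I κ`, `N ∈ I`, of class shape `IsMarkmanKappaShape N d P ψ₀ h I κ w` ⟹ `WeilAlgebraicAll n d` for every
`2 ≤ n < N` (EVERY discriminant). [cite: Markman2025SecantWeil, §1.6 (proof of Cor. 1.6.1, first sentence; preprint)] [cite: Schoen1998HodgeWeilAddendum, §10] -/
theorem weilAlgebraicAll_of_reach_of_localVariationalHodgeFor_of_isMarkmanKappaShape_lt (hF : weilFamilyReach_hyperbolic)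
    (hT : LocalVariationalHodgeFor 𝒪) {N d : ℕ} (hd : 0 < d) (P : AbelianVariety ℂ) (ψ₀ : P ⟶ P)
    (ι : ProjectiveEmbedding P.X) (a : complexBetti (projectiveSpace ι.n ℂ) 2) (hP : P.dim = 2 * N)
    (hψ : ψ₀ ≫ ψ₀ = -(d • 𝟙 P)) (ha : IsRationalClass a) (ha0 : a ≠ 0) {h : complexBetti P.X 2} {m : ℚ} (hm : m ≠ 0)
    (hι : complexBetti.map ι.ι 2 a = ((m : ℚ) : ℂ) • h) (hψh : complexBetti.map ψ₀.hom.hom.hom 2 h = (d : ℂ) • h)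
    (hhyp : IsHyperbolicWeilType P ψ₀ N h) {I : Finset ℕ} {κ : (p : ℕ) → complexBetti P.X (2 * p)}
    {w : complexBetti P.X (2 * N)} (hS : IsMarkmanKappaShape N d P ψ₀ h I κ w) (hNI : N ∈ I) (h𝒪 : 𝒪 (2 * N) P.X I κ)
    {n : ℕ} (hn : 2 ≤ n) (hnN : n < N) : WeilAlgebraicAll n d :=
  weilAlgebraicAll_of_localVariationalHodgeFor_of_hyperbolicSeedOn_lt hF hT
    (hS.hasHyperbolicSeedOn_of_polarization hd P ψ₀ ι a hP hψ ha ha0 hm hι hψh hhyp hNI h𝒪) hn hnN hd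

/-- **[Mar25] §1.6, first sentence, for `K = ℚ(√-d)`: the conditional SIXFOLD statement ⟹ the Hodge–Weil classes of EVERY
`√-d`-Weil abelian FOURFOLD are algebraic, all discriminants** (`WeilAlgebraicAll 2 d`); hypotheses = those of
`weilSixfoldsSplit_of_reach_of_localVariationalHodgeFor_of_isMarkmanKappaShape`; instance `N = 3`, `n = 2` of `…_lt`.
[cite: Markman2025SecantWeil, §1.6 (proof of Cor. 1.6.1, first sentence) and Thm. 1.5.1 (preprint)] [cite: Schoen1998HodgeWeilAddendum, §10] -/
theorem weilAlgebraicAll_two_of_reach_of_localVariationalHodgeFor_of_isMarkmanKappaShape_sixfold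
    (hF : weilFamilyReach_hyperbolic) (hT : LocalVariationalHodgeFor 𝒪) {d : ℕ} (hd : 0 < d) (P : AbelianVariety ℂ)
    (ψ₀ : P ⟶ P) (ι : ProjectiveEmbedding P.X) (a : complexBetti (projectiveSpace ι.n ℂ) 2) (hP : P.dim = 2 * 3)
    (hψ : ψ₀ ≫ ψ₀ = -(d • 𝟙 P)) (ha : IsRationalClass a) (ha0 : a ≠ 0) {h : complexBetti P.X 2} {m : ℚ} (hm : m ≠ 0)
    (hι : complexBetti.map ι.ι 2 a = ((m : ℚ) : ℂ) • h) (hψh : complexBetti.map ψ₀.hom.hom.hom 2 h = (d : ℂ) • h)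
    (hhyp : IsHyperbolicWeilType P ψ₀ 3 h) {I : Finset ℕ} {κ : (p : ℕ) → complexBetti P.X (2 * p)}
    {w : complexBetti P.X (2 * 3)} (hS : IsMarkmanKappaShape 3 d P ψ₀ h I κ w) (h3I : 3 ∈ I) (h𝒪 : 𝒪 (2 * 3) P.X I κ) :
    WeilAlgebraicAll 2 d :=
  weilAlgebraicAll_of_reach_of_localVariationalHodgeFor_of_isMarkmanKappaShape_lt hF hT hd P ψ₀ ι a hP hψ ha ha0 hm hι hψh hhyp
    hS h3I h𝒪 (le_refl 2) (by norm_num)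

/-- **… hence every FOURFOLD CELL `(2, K = ℚ(√-d), δ)`, split and non-split alike** («for all discriminants» read cell by cell through
`weilClassesComponent_of_weilAlgebraicAll`). [cite: Markman2025SecantWeil, §1.6 (proof of Cor. 1.6.1, first sentence; preprint)]
[cite: Schoen1998HodgeWeilAddendum, §10] [cite: vanGeemen1994HodgeAV, 4.14 and Lemma 5.2] -/
theorem weilFourfoldComponent_of_reach_of_localVariationalHodgeFor_of_isMarkmanKappaShape_sixfold
    (hF : weilFamilyReach_hyperbolic) (hT : LocalVariationalHodgeFor 𝒪) {d : ℕ} (hd : 0 < d) (P : AbelianVariety ℂ)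
    (ψ₀ : P ⟶ P) (ι : ProjectiveEmbedding P.X) (a : complexBetti (projectiveSpace ι.n ℂ) 2) (hP : P.dim = 2 * 3)
    (hψ : ψ₀ ≫ ψ₀ = -(d • 𝟙 P)) (ha : IsRationalClass a) (ha0 : a ≠ 0) {h : complexBetti P.X 2} {m : ℚ} (hm : m ≠ 0)
    (hι : complexBetti.map ι.ι 2 a = ((m : ℚ) : ℂ) • h) (hψh : complexBetti.map ψ₀.hom.hom.hom 2 h = (d : ℂ) • h)
    (hhyp : IsHyperbolicWeilType P ψ₀ 3 h) {I : Finset ℕ} {κ : (p : ℕ) → complexBetti P.X (2 * p)}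
    {w : complexBetti P.X (2 * 3)} (hS : IsMarkmanKappaShape 3 d P ψ₀ h I κ w) (h3I : 3 ∈ I) (h𝒪 : 𝒪 (2 * 3) P.X I κ)
    (δ : weilNormResidueGroup d) : WeilClassesComponent 2 d δ :=
  weilClassesComponent_of_weilAlgebraicAll
    (weilAlgebraicAll_two_of_reach_of_localVariationalHodgeFor_of_isMarkmanKappaShape_sixfold hF hT hd P ψ₀ ι a hP hψ ha ha0
      hm hι hψh hhyp hS h3I h𝒪) δ

end FourfoldCells

/-! ## §6 (appended) The SPLIT statements of `MarkmanClassStatementAssembly.lean` in the cell currency: `δ = [(-1)ⁿ]`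

`Stubs.WeilAlgebraicSplitHyperplane N d` (members HYPERBOLIC for some `K`-symmetrised class) versus the split CELL `WeilClassesComponent
N d [(-1)ᴺ]` (members POLARIZED with `det H = (-1)ᴺ`): the passage is Landherr's converse «`det H = (-1)ⁿ` ⟹ hyperbolic» (tree THEOREM
`VanGeemen1994.isHyperbolicWeilType_of_hasWeilDiscriminantNondeg_split`); the zero class is algebraic trivially. A re-indexing only. -/

section SplitCell

open Summit.HodgeConjecture.HodgeConjecture.Cruxes.HodgeAbelianVarieties.EStepSecantInduction

variable {𝒪 : ObjClass}

/-- **Split hyperplane sector ⟹ split cell** (fact-free re-indexing): `Stubs.WeilAlgebraicSplitHyperplane n d` (`n, d ≥ 1`) gives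
`WeilClassesComponent n d [(-1)ⁿ]` (a member polarized with `det H = (-1)ⁿ` carrying a non-zero rational `(n,n)` Weil class is hyperbolic:
`isHyperbolicWeilType_of_hasWeilDiscriminantNondeg_split`). [cite: vanGeemen1994HodgeAV, 5.4 and (5.4.1)] [cite: Markman2025SecantWeil, §1.1 (preprint)] -/
theorem weilClassesComponent_split_of_weilAlgebraicSplitHyperplane {n d : ℕ} (hn : 0 < n) (hd : 0 < d)
    (h : Stubs.WeilAlgebraicSplitHyperplane n d) : WeilClassesComponent n d (splitDiscriminantClass n d) := by
  intro A φ hA _ hφ e a ha ha0 hδ c hcr hcH hcW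
  by_cases hc0 : c = 0
  · rw [hc0]
    exact Submodule.zero_mem _
  · exact h A φ e a hA hφ ha ha0
      (isHyperbolicWeilType_of_hasWeilDiscriminantNondeg_split hn hA hd hφ e ha ha0 ⟨c, hcW, hcr, hcH, hc0⟩ hδ) c hcW hcr hcH

/-- **Markman's class statement on the SPLIT component, cell form, any `N ≥ 1`**: the hypotheses of
`splitHyperplane_of_reach_of_localVariationalHodgeFor_of_isMarkmanKappaShape` ⟹ the split CELL `WeilClassesComponent N d [(-1)ᴺ]` (the
census's row currency). In print for `N = 2` ([Mar23] J. Eur. Math. Soc. 25 (2023) Thm. 1.5 = Thm. 13.4, p. 236) and `N = 3` ([Mar25] Thm. 1.5.1, preprint); nothing for `N ≥ 4`.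
[cite: Markman2025SurveySecant, §4] [cite: Markman2023GeneralizedKummers, Thm. 1.5 (= Thm. 13.4), p. 236 (the case N = 2 in print; arXiv:1805.11574 pre-publication numbering: Thm. 1.3)]
[cite: Markman2025SecantWeil, Thm. 1.5.1 and §1.1 (preprint)] [cite: Deligne1982HodgeCycles, proof of Thm. 4.8] -/
theorem weilClassesComponent_split_of_reach_of_localVariationalHodgeFor_of_isMarkmanKappaShape
    (hF : weilFamilyReach_hyperbolic) (hT : LocalVariationalHodgeFor 𝒪) {N d : ℕ} (hN : 1 ≤ N) (hd : 0 < d)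
    (P : AbelianVariety ℂ) (ψ₀ : P ⟶ P) (ι : ProjectiveEmbedding P.X) (a : complexBetti (projectiveSpace ι.n ℂ) 2)
    (hP : P.dim = 2 * N) (hψ : ψ₀ ≫ ψ₀ = -(d • 𝟙 P)) (ha : IsRationalClass a) (ha0 : a ≠ 0) {h : complexBetti P.X 2}
    {m : ℚ} (hm : m ≠ 0) (hι : complexBetti.map ι.ι 2 a = ((m : ℚ) : ℂ) • h)
    (hψh : complexBetti.map ψ₀.hom.hom.hom 2 h = (d : ℂ) • h) (hhyp : IsHyperbolicWeilType P ψ₀ N h) {I : Finset ℕ}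
    {κ : (p : ℕ) → complexBetti P.X (2 * p)} {w : complexBetti P.X (2 * N)} (hS : IsMarkmanKappaShape N d P ψ₀ h I κ w)
    (hNI : N ∈ I) (h𝒪 : 𝒪 (2 * N) P.X I κ) : WeilClassesComponent N d (splitDiscriminantClass N d) :=
  weilClassesComponent_split_of_weilAlgebraicSplitHyperplane hN hd
    (splitHyperplane_of_reach_of_localVariationalHodgeFor_of_isMarkmanKappaShape hF hT hN hd P ψ₀ ι a hP hψ ha ha0 hm hι hψh
      hhyp hS hNI h𝒪)

end SplitCell

/-! ## §7 (appended) Route (C) on REAL carriers, any component: the census-row template for a NON-SPLIT perfect-complex row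

Route (C)'s object door (p4/p7: `PerfectComplexRankDoor.lean`, `AmplificationChainG4RouteC.lean`) with EVERY binder a real carrier except
the transfer `PerfectComplexRankTransfer C` — p4's NAMED ASSUMPTION for the real rank class `rankObjClass C` (printed strength on paper: BF 2008
Prop. 6.4.4 for the rank leg, Pridham 2024 Cor. 2.25 / Rem. 2.27 + Perry 2022 Prop. 8.1 for complexes; the kernel does not link `rankAdmissible`
to those sources; NOT a refereed fact), taken BY NAME — p7's `g = 4`
`weilFourfoldsSplit_of_reach_of_perfectComplexRankTransfer_of_isMarkmanKappaShape` moved to an ARBITRARY component `(n, K, δ)` (t-7's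
`weilSixfoldComponent_of_perfectComplexRankTransfer_of_seedOn_member` is the seed-level sibling). No census row is claimed to supply `E`. -/

section RouteC

open Literature.AlgebraicGeometry.KTheory

/-- **Route (C), any component `(n, K = ℚ(√-d), δ)`, κ-shape form on real carriers.** BY NAME: `weilFamilyReach_similar` (REFEREED),
`PerfectComplexRankTransfer C` (p4's ASSUMPTION). BY VALUE: a polarized Weil-type `(n, d)` anchor `(P, ψ₀, h)` in Markman's polarization
with `det H = δ`; a RANK-ADMISSIBLE bounded complex of vector bundles `E` on `P` (`rankAdmissible C (2n) P.X I E`, as defined there), `n ∈ I`,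
with `IsMarkmanKappaShape n d P ψ₀ h I (ch E) w` (`ch_n(E) = q·hⁿ + w`, `w ≠ 0` rational Weil, `ch_p(E) ∈ ℚ·hᵖ` on `I`) ⟹
`WeilClassesComponent n d δ` (`…_polarization` at `𝒪 := rankObjClass C`, the object witnessed by `E`). [cite: BuchweitzFlenner2008HH, Prop. 6.4.4]
[cite: Markman2025SurveySecant, §4] [cite: Markman2025SecantWeil, §1.1 (preprint)] [cite: Deligne1982HodgeCycles, proof of Thm. 4.8] -/
theorem weilClassesComponent_of_reachSimilar_of_perfectComplexRankTransfer_of_isMarkmanKappaShape (C : ChernCharacterBetti)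
    {n d : ℕ} {δ : weilNormResidueGroup d} (hF : weilFamilyReach_similar) (hT : PerfectComplexRankTransfer C)
    {P : AbelianVariety ℂ} {ψ₀ : P ⟶ P} (hW : IsWeilType P ψ₀ n d) (ι : ProjectiveEmbedding P.X)
    {a : complexBetti (projectiveSpace ι.n ℂ) 2} (ha : IsRationalClass a) (ha0 : a ≠ 0) {h : complexBetti P.X 2} {m : ℚ}
    (hm : m ≠ 0) (hι : complexBetti.map ι.ι 2 a = ((m : ℚ) : ℂ) • h) (hψh : complexBetti.map ψ₀.hom.hom.hom 2 h = (d : ℂ) • h)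
    (hδ : HasWeilDiscriminantNondeg P ψ₀ n d h δ) {I : Finset ℕ} (hnI : n ∈ I) (E : CochainComplex P.X.left.Modules ℤ)
    (hE : IsBoundedVBComplex E) (hAdm : rankAdmissible C (2 * n) P.X I E) {w : complexBetti P.X (2 * n)}
    (hκ : IsMarkmanKappaShape n d P ψ₀ h I (fun p ↦ chPerfect C P.X E hE.isFiniteLocallyFree p) w) :
    WeilClassesComponent n d δ :=
  weilClassesComponent_of_reachSimilar_of_localVariationalHodgeFor_of_isMarkmanKappaShape_polarization hF
    hT.localVariationalHodgeFor hW ι ha ha0 hm hι hψh hδ hκ hnI ⟨E, hE, hAdm, fun _ _ ↦ rfl⟩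

/-- **`g = 6`, route (C), any sixfold component — the census-row template for a NON-SPLIT perfect-complex row, κ-shape form**
(instance `n = 3` of the previous theorem): reach and `PerfectComplexRankTransfer C` BY NAME; a Weil-type `(3, d)` anchor in Markman's
polarization with `det H = δ`, a rank-admissible `E` (`rankAdmissible C 6 P.X I E`, `3 ∈ I`) with `ch₃(E) = q·h³ + w`, `w ≠ 0` rational
Weil, `ch_p(E) ∈ ℚ·hᵖ` on `I` ⟹ `WeilClassesComponent 3 d δ`. OPEN in print for `δ ≠ [-1]`; no row is claimed to supply `E`.
[cite: BuchweitzFlenner2008HH, Prop. 6.4.4] [cite: Markman2025SurveySecant, §4] [cite: Deligne1982HodgeCycles, proof of Thm. 4.8] -/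
theorem weilSixfoldComponent_of_reachSimilar_of_perfectComplexRankTransfer_of_isMarkmanKappaShape (C : ChernCharacterBetti)
    {d : ℕ} {δ : weilNormResidueGroup d} (hF : weilFamilyReach_similar) (hT : PerfectComplexRankTransfer C)
    {P : AbelianVariety ℂ} {ψ₀ : P ⟶ P} (hW : IsWeilType P ψ₀ 3 d) (ι : ProjectiveEmbedding P.X)
    {a : complexBetti (projectiveSpace ι.n ℂ) 2} (ha : IsRationalClass a) (ha0 : a ≠ 0) {h : complexBetti P.X 2} {m : ℚ}
    (hm : m ≠ 0) (hι : complexBetti.map ι.ι 2 a = ((m : ℚ) : ℂ) • h) (hψh : complexBetti.map ψ₀.hom.hom.hom 2 h = (d : ℂ) • h)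
    (hδ : HasWeilDiscriminantNondeg P ψ₀ 3 d h δ) {I : Finset ℕ} (h3I : 3 ∈ I) (E : CochainComplex P.X.left.Modules ℤ)
    (hE : IsBoundedVBComplex E) (hAdm : rankAdmissible C (2 * 3) P.X I E) {w : complexBetti P.X (2 * 3)}
    (hκ : IsMarkmanKappaShape 3 d P ψ₀ h I (fun p ↦ chPerfect C P.X E hE.isFiniteLocallyFree p) w) :
    WeilClassesComponent 3 d δ :=
  weilClassesComponent_of_reachSimilar_of_perfectComplexRankTransfer_of_isMarkmanKappaShape C hF hT hW ι ha ha0 hm hι hψh hδ h3I E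
    hE hAdm hκ

end RouteC

end Summit.Ventures.HSemireg

end
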